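import Summits.ResolutionOfSingularities.ResolutionOfSingularities.Theorems.EquisingularLiftEquisingularLiftNatEquinodalCoreSOfCores2
import HarnessLib

/-!
# [OURS · L1 W4.5(b) · EL♮(3) · door ν4, brick N-0 (JINIT at `RD := RPlus`), core S7 (→ half) of ✓ `coreS_of_cores₂`] THE COVER CLAUSE LANDS ON THE MARKED
# POINTS — ★ `eq_marked_point_of_isCoordVecOf`: a point of `ℙ³_k` with coordinate vector `B·vᵢ` IS `w i`

res-L1-w45b-nose-w1 g4 (WIDTH seat D-0157 DOOR 1; N-0 owner).  DEF-FREE; no `sorry`; standard axioms.  `--supports stmt-ResolutionOfSingularities-20148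
--as helper`, counted 0.

WHAT.  Binders = the binder list of the hypothesis `cores` of ✓ `coreS_of_cores₂` VERBATIM (H, ι dropped), then `(i : Fin δ) (z : ℙ³_k)` with
`IsCoordVecOf k 3 (B·vᵢ) z`; conclusion `z = w i`.  This is the «→» half of the S7 conjunct of `cores` (with the certificate's COVER clause
`¬ regular ⇒ ∃ i, IsCoordVecOf (B·vᵢ) z`): what remains of S7 is the «←» half (the marked points ARE non-regular points of `Z̃`, Taylor ✓ (N0-c)).
PROOF.  `w i` has the same coordinate data: for a `k`-form `f` of degree `d`, lift `F` over `O` (✓ `CILift.exists_homogeneous_lift`); `f ∈ 𝔭_{w i}` ⟺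
`w i ∈ supp (f)~` (✓ `CILift.support_projIdealSheaf_span`) ⟺ `Proj φ (w i) = 𝔰 i 𝔪 ∈ supp (F)~` (✓ `CILift.comap_projIdealSheaf_span`, `support_comap`) ⟺
`F(av i) ∈ 𝔪` (✓ S-dict) ⟺ `f(θ ∘ av i) = 0` ⟺ `f(B·vᵢ) = 0` (`θ ∘ av i = θ(u)⁻¹ • B·vᵢ`, homogeneity); two points with the same homogeneous members coincide
(`HomogeneousIdeal.ext'`).  EL♮(3) is NOT proved; resolution in positive characteristic is NOT proved.
-/

set_option linter.dupNamespace false -- mandated namespace `Summit.<Summit>.<Problem>` of this single-conjunct summit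
set_option linter.overlappingInstances false -- signatures carry `[IsDomain O] [IsDiscreteValuationRing O]`

noncomputable section

open CategoryTheory CategoryTheory.Limits AlgebraicGeometry TopologicalSpace Topology IsLocalRing
open MvPolynomial
open Literature.AlgebraicGeometry.Resolution
open AlgebraicGeometry.Scheme.IdealSheafData
open Summit.ResolutionOfSingularities.ResolutionOfSingularities.Theses.EquisingularLift.Split
open Summit.ResolutionOfSingularities.ResolutionOfSingularities.Cruxes.EquisingularLift.StrataSplit

namespace Summit.ResolutionOfSingularities.ResolutionOfSingularities.Cruxes.EquisingularLiftNat.Sections.Equinodal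

/-- ★ **CORE S7, «→» HALF: the point with homogeneous coordinates `B·vᵢ` is the marked point `w i`.**  See the module docstring.
[OURS · brick N-0 · core S7 (→); counted 0] -/
theorem eq_marked_point_of_isCoordVecOf (k : Type) [Field k] [IsAlgClosed k] :
    ∀ (O : Type) [CommRing O] [IsDomain O] [IsDiscreteValuationRing O] [IsAdicComplete (IsLocalRing.maximalIdeal O) O]
        [IsAlgClosed (IsLocalRing.ResidueField O)] (θ : O →+* k), Function.Surjective θ →
      (letI := MvPolynomial.gradedAlgebra (σ := Fin (3 + 1)) (R := O); letI := MvPolynomial.gradedAlgebra (σ := Fin (3 + 1)) (R := k);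
       ∀ (φ : MvPolynomial.homogeneousSubmodule (Fin (3 + 1)) O →+*ᵍ MvPolynomial.homogeneousSubmodule (Fin (3 + 1)) k)
        (hφ' : HomogeneousIdeal.irrelevant (MvPolynomial.homogeneousSubmodule (Fin (3 + 1)) k) ≤ (HomogeneousIdeal.irrelevant (MvPolynomial.homogeneousSubmodule (Fin (3 + 1)) O)).map φ), (∀ s, φ s = MvPolynomial.map θ s) →
        AlgebraicGeometry.IsIntegral (AlgebraicGeometry.Proj (MvPolynomial.homogeneousSubmodule (Fin (3 + 1)) O)) → IsLocallyNoetherian (AlgebraicGeometry.Proj (MvPolynomial.homogeneousSubmodule (Fin (3 + 1)) O)) → Literature.AlgebraicGeometry.Resolution.Scheme.IsRegular (AlgebraicGeometry.Proj (MvPolynomial.homogeneousSubmodule (Fin (3 + 1)) O)) → AlgebraicGeometry.IsProper (AlgebraicGeometry.Proj.toSpecZero (MvPolynomial.homogeneousSubmodule (Fin (3 + 1)) O) ≫ AlgebraicGeometry.Spec.map (CommRingCat.ofHom (algebraMap O (MvPolynomial.homogeneousSubmodule (Fin (3 + 1)) O 0)))) → AlgebraicGeometry.SmoothOfRelativeDimension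 3 (AlgebraicGeometry.Proj.toSpecZero (MvPolynomial.homogeneousSubmodule (Fin (3 + 1)) O) ≫ AlgebraicGeometry.Spec.map (CommRingCat.ofHom (algebraMap O (MvPolynomial.homogeneousSubmodule (Fin (3 + 1)) O 0)))) →
      -- the door's `ℓ`, `Z` and the CERTIFICATE data (`EqCertAt₀ k 3 ℓ Z hZ` unpacked)
      ∀ (ℓ : MvPolynomial (Fin (3 + 1)) k) (Z : Set (Literature.AlgebraicGeometry.Motives.projectiveSpace 3 k).left) (hZ : IsClosed Z) (e δ : ℕ) (g : MvPolynomial (Fin (3 + 1)) k)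
        (B : Fin (3 + 1) → Fin 3 → k) (c a b : Fin 3) (v : Fin δ → Fin 3 → k) (r : Fin 3 → Fin (3 + 1)),
        g.IsHomogeneous e → Squarefree (restrictToHyperplane B g) →
        Z = {y : (Literature.AlgebraicGeometry.Motives.projectiveSpace 3 k).left | ℓ ∈ (y : ProjectiveSpectrum (MvPolynomial.homogeneousSubmodule (Fin (3 + 1)) k)).asHomogeneousIdeal ∧ g ∈ (y : ProjectiveSpectrum (MvPolynomial.homogeneousSubmodule (Fin (3 + 1)) k)).asHomogeneousIdeal} →
        restrictToHyperplane B ℓ = 0 → Function.Injective r → ((c : ℕ) = 2 ∧ (a : ℕ) = 0 ∧ (b : ℕ) = 1) →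
        (∀ i, v i c = 1 ∧ MvPolynomial.eval (v i) (restrictToHyperplane B g) = 0 ∧
          (∀ j, MvPolynomial.eval (v i) (MvPolynomial.pderiv j (restrictToHyperplane B g)) = 0) ∧ hessBlock (restrictToHyperplane B g) a b (v i) ≠ 0) →
        (∀ z : ↥(redSub (Literature.AlgebraicGeometry.Motives.projectiveSpace 3 k).left Z hZ), IsClosed ({z} : Set ↥(redSub (Literature.AlgebraicGeometry.Motives.projectiveSpace 3 k).left Z hZ)) → ¬ IsRegularLocalRing ((redSub (Literature.AlgebraicGeometry.Motives.projectiveSpace 3 k).left Z hZ).presheaf.stalk z) →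
          ∃ i, IsCoordVecOf k 3 (fun s => ∑ j, B s j * v i j) (redSubι (Literature.AlgebraicGeometry.Motives.projectiveSpace 3 k).left Z hZ z : (Literature.AlgebraicGeometry.Motives.projectiveSpace 3 k).left)) →
        Function.Injective v →
      -- the LIFTED HYPERPLANE data (✓ `HyperplaneLift.exists_hyperplane_lift`)
      ∀ (a₀ : Fin (3 + 1)) (Bt : Fin (3 + 1) → Fin 3 → O) (ct : Fin (3 + 1) → O) (Nt : Fin 3 → Fin 3 → O),
        (∀ j, r j ≠ a₀) → (∀ a' j, θ (Bt a' j) = B a' j) → IsUnit (Matrix.of fun j j' : Fin 3 => Bt (r j) j').det → ct a₀ = 1 →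
        MvPolynomial.aeval (fun a' : Fin (3 + 1) => ∑ j : Fin 3, MvPolynomial.C (Bt a' j) * MvPolynomial.X j) (∑ a, MvPolynomial.C (ct a) * MvPolynomial.X a : MvPolynomial (Fin (3 + 1)) O) = 0 →
        (∀ G : MvPolynomial (Fin 3) O, MvPolynomial.aeval (fun a' : Fin (3 + 1) => ∑ j : Fin 3, MvPolynomial.C (Bt a' j) * MvPolynomial.X j)
          (MvPolynomial.aeval (fun i : Fin 3 => ∑ j : Fin 3, MvPolynomial.C (Nt i j) * MvPolynomial.X (r j)) G) = G) →
        (∀ f : MvPolynomial (Fin (3 + 1)) O, MvPolynomial.aeval (fun a' : Fin (3 + 1) => ∑ j : Fin 3, MvPolynomial.C (Bt a' j) * MvPolynomial.X j) f = 0 → (∑ a, MvPolynomial.C (ct a) * MvPolynomial.X a : MvPolynomial (Fin (3 + 1)) O) ∣ f) →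
        {y : (Literature.AlgebraicGeometry.Motives.projectiveSpace 3 k).left | ℓ ∈ (y : ProjectiveSpectrum (MvPolynomial.homogeneousSubmodule (Fin (3 + 1)) k)).asHomogeneousIdeal} = {y : (Literature.AlgebraicGeometry.Motives.projectiveSpace 3 k).left | (∑ a', MvPolynomial.C (θ (ct a')) * MvPolynomial.X a' : MvPolynomial (Fin (3 + 1)) k) ∈ (y : ProjectiveSpectrum (MvPolynomial.homogeneousSubmodule (Fin (3 + 1)) k)).asHomogeneousIdeal} →
      -- the EQUINODAL LIFT (✓ `exists_equinodal_lift_of_cert_of_surjective`)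
      ∀ (Gt : MvPolynomial (Fin 3) O) (nO : Fin δ → Fin 3 → O),
        Gt.IsHomogeneous e → MvPolynomial.map θ Gt = restrictToHyperplane B g → (∀ i j, θ (nO i j) = v i j) → (∀ i, nO i 2 = 1) →
        (∀ i, MvPolynomial.eval (nO i) Gt = 0 ∧ ∀ j, MvPolynomial.eval (nO i) (MvPolynomial.pderiv j Gt) = 0) →
        (∀ i, IsUnit (MvPolynomial.eval (nO i) (MvPolynomial.pderiv 0 (MvPolynomial.pderiv 0 Gt)) * MvPolynomial.eval (nO i) (MvPolynomial.pderiv 1 (MvPolynomial.pderiv 1 Gt))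
          - MvPolynomial.eval (nO i) (MvPolynomial.pderiv 0 (MvPolynomial.pderiv 1 Gt)) ^ 2)) →
      -- the two models' degree certificates (so the ideal sheaves below are well-formed)
      ∀ (hL : ∀ l, (![(∑ a, MvPolynomial.C (ct a) * MvPolynomial.X a : MvPolynomial (Fin (3 + 1)) O)] : Fin 1 → MvPolynomial (Fin (3 + 1)) O) l ∈ MvPolynomial.homogeneousSubmodule (Fin (3 + 1)) O ((![1] : Fin 1 → ℕ) l))
        (hF : ∀ l, (![(∑ a, MvPolynomial.C (ct a) * MvPolynomial.X a : MvPolynomial (Fin (3 + 1)) O), (MvPolynomial.aeval (fun i : Fin 3 => ∑ j : Fin 3, MvPolynomial.C (Nt i j) * MvPolynomial.X (r j)) Gt : MvPolynomial (Fin (3 + 1)) O)] : Fin 2 → MvPolynomial (Fin (3 + 1)) O) l ∈ MvPolynomial.homogeneousSubmodule (Fin (3 + 1)) O ((![1, e] : Fin 2 → ℕ) l)),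
      -- the NODE SECTIONS `𝔰 i = [av i]`, `av i = uᵢ⁻¹ • B̃·nO i` (✓ SectionOfVec), and the marked closed points `w i`
      ∀ (av : Fin δ → Fin (3 + 1) → O) (dv : Fin δ → Fin (3 + 1)) (hav : ∀ i, av i (dv i) = 1),
        (∀ i, ∃ u : O, IsUnit u ∧ ∀ a', u * av i a' = ∑ j : Fin 3, Bt a' j * nO i j) →
      ∀ (𝔰 : Fin δ → (AlgebraicGeometry.Spec (.of O) ⟶ (AlgebraicGeometry.Proj (MvPolynomial.homogeneousSubmodule (Fin (3 + 1)) O)))),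
        (∀ i, 𝔰 i = (AlgebraicGeometry.Spec.map (CommRingCat.ofHom ((Localization.awayLift (MvPolynomial.eval (av i)) (MvPolynomial.X (dv i) : MvPolynomial (Fin (3 + 1)) O)
            (SectionOfVec.isUnit_eval_X (av i) (dv i) (hav i))).comp
          (algebraMap (HomogeneousLocalization.Away (MvPolynomial.homogeneousSubmodule (Fin (3 + 1)) O) (MvPolynomial.X (dv i) : MvPolynomial (Fin (3 + 1)) O))
            (Localization.Away (MvPolynomial.X (dv i) : MvPolynomial (Fin (3 + 1)) O))))) ≫
          AlgebraicGeometry.Proj.awayι (MvPolynomial.homogeneousSubmodule (Fin (3 + 1)) O) (MvPolynomial.X (dv i)) (MvPolynomial.isHomogeneous_X O (dv i)) one_pos)) →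
      ∀ (w : Fin δ → (Literature.AlgebraicGeometry.Motives.projectiveSpace 3 k).left), (∀ i, (AlgebraicGeometry.Proj.map φ hφ' : (Literature.AlgebraicGeometry.Motives.projectiveSpace 3 k).left ⟶ (AlgebraicGeometry.Proj (MvPolynomial.homogeneousSubmodule (Fin (3 + 1)) O))) (w i) = 𝔰 i (IsLocalRing.closedPoint O)) →
      ∀ (i : Fin δ) (z : (Literature.AlgebraicGeometry.Motives.projectiveSpace 3 k).left), IsCoordVecOf k 3 (fun s => ∑ j, B s j * v i j) z → z = w i) := by
  classical
  intro O _ _ _ _ _ θ hθ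
  letI := MvPolynomial.gradedAlgebra (σ := Fin (3 + 1)) (R := O)
  letI := MvPolynomial.gradedAlgebra (σ := Fin (3 + 1)) (R := k)
  intro φ hφ' hφ hPint hPnoeth hPreg hqprop hqsm ℓ Z hZ e δ g B c a b v r hg hsq hZeq hℓB hr hcab hmarked hcover hvinj a₀ Bt ct Nt ha₀ hBt
    hdett hcta₀ hψt hsect hkert hVlin Gt nO hGt hGtg hnO hn2 hnode hHess hL hF av dv hav hab 𝔰 h𝔰 w hw i z hz
  have hφX : ∀ i₁ : Fin (3 + 1), φ (X i₁) = X i₁ := fun i₁ => by rw [hφ, map_X]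
  -- the reduction of `av i` is a unit multiple of `B·vᵢ`
  obtain ⟨u, hu, hua⟩ := hab i
  have hθu : θ u ≠ 0 := by
    intro h0
    have hm : u ∈ IsLocalRing.maximalIdeal O := by rw [← ker_eq_maximalIdeal_of_surjective θ hθ]; exact h0
    exact (IsLocalRing.maximalIdeal.isMaximal O).ne_top (Ideal.eq_top_of_isUnit_mem _ hm hu)
  have hθav : ∀ s, θ (av i s) = (θ u)⁻¹ * ∑ j, B s j * v i j := by
    intro s
    have h := congrArg θ (hua s)
    rw [map_mul, map_sum] at h
    simp_rw [map_mul, hBt, hnO] at h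
    rw [← h, ← mul_assoc, inv_mul_cancel₀ hθu, one_mul]
  -- the coordinate dictionary of `w i`
  have hwi : IsCoordVecOf k 3 (fun s => ∑ j, B s j * v i j) (w i) := by
    intro d f hfd
    have hfd' : f ∈ homogeneousSubmodule (Fin (3 + 1)) k d := hfd
    obtain ⟨F, hFd, hFf⟩ := CILift.exists_homogeneous_lift θ hθ f hfd'
    have hF1 : ∀ l, (![F] : Fin 1 → MvPolynomial (Fin (3 + 1)) O) l ∈ homogeneousSubmodule (Fin (3 + 1)) O ((![d] : Fin 1 → ℕ) l) := by
      intro l; fin_cases l; exact hFd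
    have hf1 : ∀ l, (![f] : Fin 1 → MvPolynomial (Fin (3 + 1)) k) l ∈ homogeneousSubmodule (Fin (3 + 1)) k ((![d] : Fin 1 → ℕ) l) := by
      intro l; fin_cases l; exact hfd'
    have hφF : ∀ l, φ ((![F] : Fin 1 → MvPolynomial (Fin (3 + 1)) O) l) = (![f] : Fin 1 → MvPolynomial (Fin (3 + 1)) k) l := by
      intro l; fin_cases l; change φ F = f; rw [hφ, hFf]
    -- `f ∈ 𝔭_{w i}` ⟺ `w i ∈ supp (f)~`
    have h1 : f ∈ (w i : ProjectiveSpectrum (MvPolynomial.homogeneousSubmodule (Fin (3 + 1)) k)).asHomogeneousIdeal ↔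
        w i ∈ ((projIdealSheaf (homogeneousSubmodule (Fin (3 + 1)) k)
          ⟨Ideal.span (Set.range ![f]), isHomogeneous_span_of_forall_mem _ _ _ hf1⟩).support : Set (Proj (homogeneousSubmodule (Fin (3 + 1)) k))) := by
      rw [CILift.support_projIdealSheaf_span ![f] ![d] hf1]
      simp only [Fin.forall_fin_one, Matrix.cons_val_zero]
      rfl
    -- `(f)~ = (F)~ · 𝒪_{ℙ³_k}`, so membership is read upstairs at `𝔰 i 𝔪`
    have h2 : w i ∈ ((projIdealSheaf (homogeneousSubmodule (Fin (3 + 1)) k)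
          ⟨Ideal.span (Set.range ![f]), isHomogeneous_span_of_forall_mem _ _ _ hf1⟩).support : Set (Proj (homogeneousSubmodule (Fin (3 + 1)) k))) ↔
        𝔰 i (IsLocalRing.closedPoint O) ∈ ((projIdealSheaf (homogeneousSubmodule (Fin (3 + 1)) O)
          ⟨Ideal.span (Set.range ![F]), isHomogeneous_span_of_forall_mem _ _ _ hF1⟩).support : Set (Proj (homogeneousSubmodule (Fin (3 + 1)) O))) := by
      rw [← CILift.comap_projIdealSheaf_span φ hφ' hφX ![F] ![f] ![d] hF1 hf1 hφF, ← hw i,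
        Scheme.IdealSheafData.support_comap, TopologicalSpace.Closeds.coe_preimage]
      rfl
    -- the support dictionary and the reduction
    have h3 : 𝔰 i (IsLocalRing.closedPoint O) ∈ ((projIdealSheaf (homogeneousSubmodule (Fin (3 + 1)) O)
          ⟨Ideal.span (Set.range ![F]), isHomogeneous_span_of_forall_mem _ _ _ hF1⟩).support : Set (Proj (homogeneousSubmodule (Fin (3 + 1)) O))) ↔
        MvPolynomial.eval (fun s => ∑ j, B s j * v i j) f = 0 := by
      rw [h𝔰 i, SectionOfVec.sectionOfVec_closedPoint_mem_support_iff (av i) (dv i) (hav i) ![F] ![d] hF1]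
      simp only [Fin.forall_fin_one, Matrix.cons_val_zero]
      rw [← ker_eq_maximalIdeal_of_surjective θ hθ, RingHom.mem_ker, map_eval_eq_eval_map θ (av i) F, hFf]
      have hsc : (fun s => θ (av i s)) = fun s => (θ u)⁻¹ * ∑ j, B s j * v i j := funext hθav
      rw [hsc, eval_smul_of_mem_homogeneousSubmodule f hfd' ((θ u)⁻¹) (fun s => ∑ j, B s j * v i j)]
      constructor
      · intro h
        rcases mul_eq_zero.mp h with h0 | h0
        · exact absurd h0 (pow_ne_zero _ (inv_ne_zero hθu))
        · exact h0
      · intro h; rw [h, mul_zero]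
    exact h1.trans (h2.trans h3)
  -- two points with the same homogeneous members coincide
  apply ProjectiveSpectrum.ext
  refine HomogeneousIdeal.ext' fun d x hx => ?_
  have hxd : x.IsHomogeneous d := hx
  rw [← HomogeneousIdeal.mem_iff, ← HomogeneousIdeal.mem_iff]
  exact (hz d x hxd).trans (hwi d x hxd).symm

end Summit.ResolutionOfSingularities.ResolutionOfSingularities.Cruxes.EquisingularLiftNat.Sections.Equinodal

end
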